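import Mathlib
import Literature.MathematicalPhysics.QuantumFieldTheory.YangMillsOS
import HarnessLib

/-!
# Crux `FiniteSusceptibilityWeakCoupling` (stmt-QuantumFields-9442), line `purity-rate-split` —
# `SU(2)` has no `C`-odd local sector: every species is even under complex conjugation of the links

The rate half `DecorrelationForcesSummability` (item stmt-QuantumFields-18061) of the crux
`Summit.QuantumFields.YangMills.Theses.FradkinShenkerFlow.FiniteSusceptibilityWeakCoupling` carries the whole
load of `IsCompactSimpleLieGroup`: with simplicity deleted it is false for `U(1)` in `d = 4`, the witness being the
`C`-ODD plaquette species `U ↦ Im U_p = sin θ_p` (tree `Negative.exists_u1SinePlaquetteSpecies`,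
`Negative.rateHalf_false_without_simple_of_u1Sine`), which couples linearly to the massless photon of the Coulomb
phase. Lead c18 recorded what remains of the single-plaquette `G`-entry analysis after `SimpleRepDetOne` /
`OddTraceActionBound` / `PlaquetteCharacterOnset`: *"SU(2) has no C-odd sector"* (crux `NOTES.md` §c18;
`STRATEGY-CENSUS.md` §S⁺8 and LeverCensus lever 27: for `SU(2)` complex conjugation of all links is the global
gauge transformation by `iσ₂`). This file makes that remark a kernel fact, in the route's vocabulary
(`YMSpecies G = LocalGaugeObservable 4 G`, `gaugeTransformZd`):

* `species_inner_even` — for EVERY group `G` and every `h : G`, every species is invariant under the global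
  inner automorphism `U_e ↦ h U_e h⁻¹` of all links (it is the gauge transformation by the constant function `h`);
* `SU2ConjugationEven.coe_conj_eq_map_star` — in `SU(2)`, complex conjugation is inner: with
  `J = !![0, 1; -1, 0] ∈ SU(2)`, `J g J⁻¹ = ḡ` (entrywise conjugate) for every `g ∈ SU(2)` (a unitary `2 × 2` matrix
  of determinant one has `gᴴ = adj g`, so `ḡ = !![d, -c; -b, a]` for `g = !![a, b; c, d]`, which is `J g J⁻¹`);
* `su2_species_conj_even` — hence every species `A : YMSpecies SU(2)` satisfies `A.F Ū = A.F U` whenever `Ū` is the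
  entrywise complex conjugate of the configuration `U` (all links conjugated): the charge-conjugation sector that
  carries the `U(1)₄` counter-mechanism is EMPTY for `SU(2)` at the level of bounded gauge-invariant cylinder functions.

Reading (for the chain of item 18061, census §N10): for `SU(2)` an "emergent photon" would have to be visible through
`C`-even bounded local functionals; for `SU(N ≥ 3)` conjugation is outer and a `C`-odd sector exists. Nothing here is an
engine for the rate half; it is the exact group-theoretic content of the census remark, `--supports` the crux.
Mathlib only; no named unproved facts.
-/

set_option autoImplicit false

noncomputable section

open Literature.MathematicalPhysics.QuantumFieldTheory Literature.MathematicalPhysics.QuantumLattice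

namespace Summit.QuantumFields.YangMills.Theorems.FiniteSusceptibilityWeakCoupling

/-- **Species are blind to global inner automorphisms** (every group `G`, every `h : G`): conjugating ALL links by a
fixed `h`, `U_e ↦ h U_e h⁻¹`, is the lattice gauge transformation by the constant gauge function `x ↦ h`, so every
gauge-invariant local observable takes the same value. [folklore] -/
theorem species_inner_even {G : Type} [Group G] [MeasurableSpace G] (h : G) (A : YMSpecies G) (U : LGConfig 4 G) :
    A.F (fun e => h * U e * h⁻¹) = A.F U :=
  A.gaugeInvariant (fun _ => h) U

namespace SU2ConjugationEven

/-- The matrix `J = iσ₂ = !![0, 1; -1, 0]` lies in `SU(2)`. [folklore] -/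
theorem J_mem : !![(0 : ℂ), 1; -1, 0] ∈ Matrix.specialUnitaryGroup (Fin 2) ℂ := by
  rw [Matrix.mem_specialUnitaryGroup_iff, Matrix.mem_unitaryGroup_iff]
  refine ⟨?_, ?_⟩
  · ext i j
    fin_cases i <;> fin_cases j <;>
      simp [Matrix.mul_apply, Fin.sum_univ_two, Matrix.star_eq_conjTranspose, Matrix.conjTranspose_apply]
  · simp [Matrix.det_fin_two_of]

/-- For a unitary `2 × 2` matrix of determinant one, `Mᴴ = adj M`: both are the inverse of `M`. [folklore] -/
theorem star_eq_adjugate {M : Matrix (Fin 2) (Fin 2) ℂ} (hM : M ∈ Matrix.specialUnitaryGroup (Fin 2) ℂ) :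
    star M = M.adjugate := by
  rw [Matrix.mem_specialUnitaryGroup_iff, Matrix.mem_unitaryGroup_iff'] at hM
  obtain ⟨hU, hdet⟩ := hM
  have h1 : M⁻¹ = star M := Matrix.inv_eq_left_inv hU
  have h2 : M⁻¹ = M.adjugate := by
    refine Matrix.inv_eq_left_inv ?_
    rw [Matrix.adjugate_mul, hdet, one_smul]
  rw [← h1, h2]

/-- **In `SU(2)` complex conjugation is inner**: `J g J⁻¹ = ḡ` (entrywise complex conjugate) for every `g ∈ SU(2)`,
with `J = !![0, 1; -1, 0]`. [folklore] -/
theorem coe_conj_eq_map_star (g : Matrix.specialUnitaryGroup (Fin 2) ℂ) :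
    ((⟨_, J_mem⟩ * g * (⟨_, J_mem⟩ : Matrix.specialUnitaryGroup (Fin 2) ℂ)⁻¹ :
        Matrix.specialUnitaryGroup (Fin 2) ℂ) : Matrix (Fin 2) (Fin 2) ℂ) =
      (g : Matrix (Fin 2) (Fin 2) ℂ).map star := by
  set M : Matrix (Fin 2) (Fin 2) ℂ := (g : Matrix (Fin 2) (Fin 2) ℂ) with hMdef
  have hst : star M = M.adjugate := star_eq_adjugate g.prop
  -- the four scalar identities `conj (M j i) = (adj M) i j`
  have e00 : (starRingEnd ℂ) (M 0 0) = M 1 1 := by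
    have := congrFun (congrFun hst 0) 0
    simpa [Matrix.star_eq_conjTranspose, Matrix.conjTranspose_apply, Matrix.adjugate_fin_two] using this
  have e01 : (starRingEnd ℂ) (M 1 0) = -M 0 1 := by
    have := congrFun (congrFun hst 0) 1
    simpa [Matrix.star_eq_conjTranspose, Matrix.conjTranspose_apply, Matrix.adjugate_fin_two] using this
  have e10 : (starRingEnd ℂ) (M 0 1) = -M 1 0 := by
    have := congrFun (congrFun hst 1) 0
    simpa [Matrix.star_eq_conjTranspose, Matrix.conjTranspose_apply, Matrix.adjugate_fin_two] using this
  have e11 : (starRingEnd ℂ) (M 1 1) = M 0 0 := by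
    have := congrFun (congrFun hst 1) 1
    simpa [Matrix.star_eq_conjTranspose, Matrix.conjTranspose_apply, Matrix.adjugate_fin_two] using this
  -- the group inverse in `SU(2)` is `star`
  rw [← Matrix.star_eq_inv]
  change !![(0 : ℂ), 1; -1, 0] * M * star !![(0 : ℂ), 1; -1, 0] = M.map star
  ext i j
  fin_cases i <;> fin_cases j <;>
    simp [Matrix.mul_apply, Fin.sum_univ_two, Matrix.vecMul, dotProduct, Matrix.star_eq_conjTranspose,
      Matrix.conjTranspose_apply, e00, e01, e10, e11]

/-- There is `J ∈ SU(2)` conjugating every element to its entrywise complex conjugate. [folklore] -/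
theorem exists_inner_conj : ∃ J : Matrix.specialUnitaryGroup (Fin 2) ℂ, ∀ g : Matrix.specialUnitaryGroup (Fin 2) ℂ,
    ((J * g * J⁻¹ : Matrix.specialUnitaryGroup (Fin 2) ℂ) : Matrix (Fin 2) (Fin 2) ℂ) =
      (g : Matrix (Fin 2) (Fin 2) ℂ).map star :=
  ⟨⟨_, J_mem⟩, coe_conj_eq_map_star⟩

end SU2ConjugationEven

/-- **`SU(2)` lattice gauge theory has no `C`-odd local sector.** If the configuration `V` is the link-wise complex
conjugate of `U` (`V_e = Ū_e` entrywise for every edge `e` of `ℤ⁴`), then every species — every bounded measurable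
gauge-invariant cylinder function `A : YMSpecies SU(2)` — satisfies `A.F V = A.F U`: conjugation of all links is the
global gauge transformation by `J = iσ₂` (`SU2ConjugationEven.coe_conj_eq_map_star`, `species_inner_even`). In
particular the `C`-odd species that refute the rate half `DecorrelationForcesSummability` with simplicity deleted
(`U(1)₄`: `sin θ_p`) have no `SU(2)` analogue. [folklore] -/
theorem su2_species_conj_even (A : YMSpecies (Matrix.specialUnitaryGroup (Fin 2) ℂ))
    (U V : LGConfig 4 (Matrix.specialUnitaryGroup (Fin 2) ℂ))
    (hV : ∀ e, (V e : Matrix (Fin 2) (Fin 2) ℂ) = (U e : Matrix (Fin 2) (Fin 2) ℂ).map star) :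
    A.F V = A.F U := by
  obtain ⟨J, hJ⟩ := SU2ConjugationEven.exists_inner_conj
  have hgt : (fun e => J * U e * J⁻¹) = V := by
    funext e
    exact Subtype.ext ((hJ (U e)).trans (hV e).symm)
  rw [← hgt]
  exact species_inner_even J A U

/-- The same statement with the conjugate configuration written as a function of `U`: for every species `A` of
`SU(2)` lattice gauge theory and every `J`-free description of charge conjugation as a link-wise map `c` with
`(c g : matrix) = ḡ`, `A.F (c ∘ U) = A.F U`. [folklore] -/
theorem su2_species_conj_even' (c : Matrix.specialUnitaryGroup (Fin 2) ℂ → Matrix.specialUnitaryGroup (Fin 2) ℂ)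
    (hc : ∀ g, (c g : Matrix (Fin 2) (Fin 2) ℂ) = (g : Matrix (Fin 2) (Fin 2) ℂ).map star)
    (A : YMSpecies (Matrix.specialUnitaryGroup (Fin 2) ℂ)) (U : LGConfig 4 (Matrix.specialUnitaryGroup (Fin 2) ℂ)) :
    A.F (fun e => c (U e)) = A.F U :=
  su2_species_conj_even A U (fun e => c (U e)) fun e => hc (U e)

/-- Registered stub `stub_su2SpeciesConjEven` (lead c28, `--supports stmt-QuantumFields-9442`): **every species of
`SU(2)` lattice gauge theory is even under charge conjugation** (link-wise complex conjugation of the configuration) —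
`su2_species_conj_even` with the signature spelled in fully qualified route vocabulary. [folklore] -/
theorem stub_su2SpeciesConjEven : ∀ (A : Literature.MathematicalPhysics.QuantumFieldTheory.YMSpecies (Matrix.specialUnitaryGroup (Fin 2) ℂ)) (U V : Literature.MathematicalPhysics.QuantumLattice.LGConfig 4 (Matrix.specialUnitaryGroup (Fin 2) ℂ)), (∀ e, (V e : Matrix (Fin 2) (Fin 2) ℂ) = (U e : Matrix (Fin 2) (Fin 2) ℂ).map star) → A.F V = A.F U :=
  su2_species_conj_even

end Summit.QuantumFields.YangMills.Theorems.FiniteSusceptibilityWeakCoupling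

end
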